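import Mathlib
import HarnessLib
import Literature.Analysis.FluidPDE.VectorCalculus
import Literature.Analysis.FluidPDE.AxisymmetricEuler
import Literature.Analysis.FluidPDE.SwirlTransportProofs
import Literature.Analysis.FluidPDE.AxisymmetricVorticityTransport
import Literature.Analysis.FluidPDE.CurlIsometryCovariance
import Literature.Analysis.FluidPDE.IsometryInvariance
import Literature.Analysis.FluidPDE.FlatSwirlGauge
import Literature.Analysis.FluidPDE.EulerTimeScaling
import Literature.Analysis.FluidPDE.VorticityCalculus
import Literature.Geometry.Lorentzian.KerrIngoingCoordPullback
import Summits.NavierStokesRegularity.NavierStokesRegularity.Theorems.UnthreadedRigidityDoorUnthreadedRigidityProfileHornDefs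

/-!
# Route `UnthreadedRigidityDoor`, item `UnthreadedRigidity` (W2, stmt-NavierStokesRegularity-27585) — LINE g10-2 «PROFILE HORN»:
# S-Z `ZonalSepShellAxisymUniform` BY NAME — a zonal form gives an axisymmetric shell, one generator for all profiles and centres

Prover file (W2 Lean hand ns-crc-p1 g7, keyed by DIRECTOR-NS dss_128 / KEY-NS #184; `--supports stmt-NavierStokesRegularity-27585 --as helper`)
for LINE g10-2 «PROFILE HORN» of planner ns-idea-6 g10 on the wall item `UnthreadedRigidity` (route `UnthreadedRigidityDoor`, W2;
idea-crit-4 g6 PASS 2026-08-29T01:30:55Z; sketch `pub/ideators/ns-idea-6/lines/UnthreadedRigidityDoor/ProfileHorn_sketch.lean` sha16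
916bdf9b3eac7d48; objects and statements BY NAME in `Theorems/UnthreadedRigidityDoorUnthreadedRigidityProfileHornDefs.lean`).

Part Z1 (zonal forms have an axis): for a symmetric `Q`, the spectral theorem (`Matrix.IsHermitian.eigenvectorBasis`) writes
`Y_Q(y) = Σ μₖ ⟪bₖ, y⟫²`; the discriminant cubic at `b₀ + b₁ + b₂` is the Vandermonde `(μ₁−μ₀)(μ₂−μ₀)(μ₂−μ₁) · det[b]` with `det[b]² = 1`
(orthonormal rows; the coordinate form of `⟪·,·⟫` on `E3` is reused from `Literature.Geometry.Lorentzian.Kerr.Ingoing.inner_e3`,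
the tree's landed copy — dedup rule), so `IsZonalForm Q` (after removing the unit-sphere normalisation by homogeneity) forces a repeated eigenvalue and
`Y_Q(y) = a‖y‖² + d⟪n, y⟫²` for a unit axis `n` (`zonal_structure`).
Part Z2 (the shell is axisymmetric about that axis): a Householder isometry `P` with `P e₂ = n` (`Submodule.reflection_sub`); the centred
potential field `G₀(y) = h(‖y‖²)(a‖y‖² + d⟪n,y⟫²) y` is equivariant under the rotations `P R_θ P⁻¹`; the conjugated field `P⁻¹ ∘ G₀ ∘ P` is
`IsAxisymmetric` in the tree's sense, hence so is its double curl (`IsAxisymmetric.curl` twice), which is `P⁻¹ ∘ curl curl G₀ ∘ P` by the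
pseudovector law `curl_conj_linearIsometryEquiv` applied twice (`det P · det P = 1`); `IsAxisymmetric.fderiv_rotGen` is the infinitesimal
identity, `fderiv_conj_linearIsometryEquiv` transports it back, and `curl_comp_add_const` moves the centre to `x₀`.  The generator is
`A = P ∘ rotGenL ∘ P⁻¹` — skew, non-zero, and independent of the profile `H` and of the centre `x₀`, as the statement S-Z demands.

HONEST LABEL: linear algebra and rotation-covariance bookkeeping about SPECIAL (separable `l = 2`) slice data; it is a piece of a LINE on
the wall item, not the item: `UnthreadedRigidity` (27585), W2 and NS regularity remain OPEN; nothing here is a statement about the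
Navier–Stokes equations.  0 kit.
-/

-- the summit and its single sub-problem share the name (CONVENTIONS §1), as in every Theorems file
set_option linter.dupNamespace false

namespace Summit.NavierStokesRegularity.NavierStokesRegularity.Theorems.UnthreadedRigidity.ProfileHorn

open scoped Topology InnerProductSpace
open Filter Set MeasureTheory

/-! ## Part Z1 — zonal forms have an axis -/

section Zonal

open Matrix

variable {Q : Matrix (Fin 3) (Fin 3) ℝ}

/-- a real symmetric matrix is Hermitian. -/
theorem isHermitian_of_isQuadForm (hQ : IsQuadForm Q) : Q.IsHermitian := by
  unfold Matrix.IsHermitian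
  rw [Matrix.conjTranspose_eq_transpose_of_trivial]
  exact hQ.1

/-- the `3 × 3` determinant of three rows, expanded. -/
theorem det_rows_three (r₀ r₁ r₂ : Fin 3 → ℝ) :
    Matrix.det (Matrix.of ![r₀, r₁, r₂]) =
      r₀ 0 * r₁ 1 * r₂ 2 - r₀ 0 * r₁ 2 * r₂ 1 - r₀ 1 * r₁ 0 * r₂ 2 + r₀ 1 * r₁ 2 * r₂ 0
        + r₀ 2 * r₁ 0 * r₂ 1 - r₀ 2 * r₁ 1 * r₂ 0 := by
  rw [Matrix.det_fin_three]
  simp [Matrix.of_apply]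

/-- homogeneity of the discriminant cubic: `D_Q(t y) = t³ D_Q(y)`. -/
theorem discrCubic_smul (Q : Matrix (Fin 3) (Fin 3) ℝ) (t : ℝ) (y : E3) :
    discrCubic Q (t • y) = t ^ 3 * discrCubic Q y := by
  unfold discrCubic
  have h0 : (fun i => (t • y) i) = t • (fun i => y i) := by
    funext i; simp
  rw [h0, Matrix.mulVec_smul, Matrix.mulVec_smul, det_rows_three, det_rows_three]
  simp only [Pi.smul_apply, smul_eq_mul]
  ring

/-- a zonal form vanishes its discriminant cubic at EVERY vector (homogeneity). -/
theorem discrCubic_eq_zero_of_zonal (hz : IsZonalForm Q) (y : E3) : discrCubic Q y = 0 := by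
  by_cases hy : y = 0
  · have : y = (0:ℝ) • y := by rw [hy, smul_zero]
    rw [this, discrCubic_smul]; ring
  · have hn : ‖y‖ ≠ 0 := norm_ne_zero_iff.mpr hy
    have hu : ‖(‖y‖⁻¹ • y)‖ = 1 := by
      rw [norm_smul, norm_inv, norm_norm, inv_mul_cancel₀ hn]
    have h1 := hz _ hu
    have e : y = ‖y‖ • (‖y‖⁻¹ • y) := by rw [smul_smul, mul_inv_cancel₀ hn, one_smul]
    rw [e, discrCubic_smul, h1, mul_zero]

/-- the quadratic form as `Σᵢ yᵢ (Q y)ᵢ`. -/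
theorem quadY_eq_sum_mulVec (Q : Matrix (Fin 3) (Fin 3) ℝ) (y : E3) :
    quadY Q y = ∑ i, y i * (Q *ᵥ (fun j => y j)) i := by
  unfold quadY
  refine Finset.sum_congr rfl fun i _ => ?_
  rw [Matrix.mulVec, dotProduct, Finset.mul_sum]
  refine Finset.sum_congr rfl fun j _ => ?_
  ring

/-- ZONAL STRUCTURE: a zonal symmetric form is `Y_Q(y) = a‖y‖² + d⟪n, y⟫²` for a unit vector `n` (its axis):
by the spectral theorem `Y_Q = Σ μₖ⟪bₖ, y⟫²` in an orthonormal eigenbasis, and the discriminant cubic at `b₀ + b₁ + b₂` is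
the Vandermonde `(μ₁−μ₀)(μ₂−μ₀)(μ₂−μ₁) · det[b]`, `det[b]² = 1` — so zonal forces a repeated eigenvalue. -/
theorem zonal_structure (hQ : IsQuadForm Q) (hz : IsZonalForm Q) :
    ∃ n : E3, ‖n‖ = 1 ∧ ∃ a d : ℝ, ∀ y : E3, quadY Q y = a * ‖y‖ ^ 2 + d * ⟪n, y⟫_ℝ ^ 2 := by
  have hH := isHermitian_of_isQuadForm hQ
  set b := hH.eigenvectorBasis with hb_def
  set μ := hH.eigenvalues with hμ_def
  have hb : ∀ i, Q *ᵥ (fun j => b i j) = μ i • (fun j => b i j) := fun i => hH.mulVec_eigenvectorBasis i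
  -- coordinates
  have hrepr : ∀ y : E3, y = ∑ i, ⟪b i, y⟫_ℝ • b i := fun y => by
    conv_lhs => rw [← b.sum_repr y]
    simp [OrthonormalBasis.repr_apply_apply]
  have hQy : ∀ y : E3, Q *ᵥ (fun j => y j) = ∑ i, (⟪b i, y⟫_ℝ * μ i) • (fun j => b i j) := by
    intro y
    have : (fun j => y j) = ∑ i, ⟪b i, y⟫_ℝ • (fun j => b i j) := by
      funext j
      conv_lhs => rw [hrepr y]
      simp [Finset.sum_apply]
    rw [this, Matrix.mulVec_sum]
    refine Finset.sum_congr rfl fun i _ => ?_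
    rw [Matrix.mulVec_smul, hb i, smul_smul]
  -- the quadratic form in eigen-coordinates (a polynomial identity once `⟪bₖ, y⟫` is expanded)
  have hquad : ∀ y : E3, quadY Q y = μ 0 * ⟪b 0, y⟫_ℝ ^ 2 + μ 1 * ⟪b 1, y⟫_ℝ ^ 2 + μ 2 * ⟪b 2, y⟫_ℝ ^ 2 := by
    intro y
    rw [quadY_eq_sum_mulVec, hQy y]
    simp only [Literature.Geometry.Lorentzian.Kerr.Ingoing.inner_e3, Fin.sum_univ_three, Finset.sum_apply, Pi.smul_apply, smul_eq_mul]
    ring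
  -- Parseval
  have hpars : ∀ y : E3, ‖y‖ ^ 2 = ⟪b 0, y⟫_ℝ ^ 2 + ⟪b 1, y⟫_ℝ ^ 2 + ⟪b 2, y⟫_ℝ ^ 2 := by
    intro y
    have := b.sum_sq_norm_inner_right y
    simp only [Fin.sum_univ_three, Real.norm_eq_abs, sq_abs] at this
    linarith
  -- orthonormality relations in coordinates
  have hnorm : ∀ i, ⟪b i, b i⟫_ℝ = 1 := fun i => by
    rw [real_inner_self_eq_norm_sq, b.orthonormal.1 i]; norm_num
  have horth : ∀ i j, i ≠ j → ⟪b i, b j⟫_ℝ = 0 := fun i j h => b.orthonormal.2 h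
  have h00 := hnorm 0; have h11 := hnorm 1; have h22 := hnorm 2
  have h01 := horth 0 1 (by decide); have h02 := horth 0 2 (by decide); have h12 := horth 1 2 (by decide)
  rw [Literature.Geometry.Lorentzian.Kerr.Ingoing.inner_e3] at h00 h11 h22 h01 h02 h12
  -- the discriminant cubic at `b₀ + b₁ + b₂` is Vandermonde × det[b]
  set D : ℝ := b 0 0 * b 1 1 * b 2 2 - b 0 0 * b 1 2 * b 2 1 - b 0 1 * b 1 0 * b 2 2 + b 0 1 * b 1 2 * b 2 0
    + b 0 2 * b 1 0 * b 2 1 - b 0 2 * b 1 1 * b 2 0 with hD_def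
  have hD2 : D ^ 2 = 1 := by
    have e : D ^ 2 = (b 0 0 * b 0 0 + b 0 1 * b 0 1 + b 0 2 * b 0 2)
        * ((b 1 0 * b 1 0 + b 1 1 * b 1 1 + b 1 2 * b 1 2) * (b 2 0 * b 2 0 + b 2 1 * b 2 1 + b 2 2 * b 2 2)
          - (b 1 0 * b 2 0 + b 1 1 * b 2 1 + b 1 2 * b 2 2) * (b 1 0 * b 2 0 + b 1 1 * b 2 1 + b 1 2 * b 2 2))
        - (b 0 0 * b 1 0 + b 0 1 * b 1 1 + b 0 2 * b 1 2)
        * ((b 0 0 * b 1 0 + b 0 1 * b 1 1 + b 0 2 * b 1 2) * (b 2 0 * b 2 0 + b 2 1 * b 2 1 + b 2 2 * b 2 2)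
          - (b 1 0 * b 2 0 + b 1 1 * b 2 1 + b 1 2 * b 2 2) * (b 0 0 * b 2 0 + b 0 1 * b 2 1 + b 0 2 * b 2 2))
        + (b 0 0 * b 2 0 + b 0 1 * b 2 1 + b 0 2 * b 2 2)
        * ((b 0 0 * b 1 0 + b 0 1 * b 1 1 + b 0 2 * b 1 2) * (b 1 0 * b 2 0 + b 1 1 * b 2 1 + b 1 2 * b 2 2)
          - (b 1 0 * b 1 0 + b 1 1 * b 1 1 + b 1 2 * b 1 2) * (b 0 0 * b 2 0 + b 0 1 * b 2 1 + b 0 2 * b 2 2)) := by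
      rw [hD_def]; ring
    rw [e, h00, h11, h22, h01, h02, h12]; norm_num
  have hD : D ≠ 0 := fun h => by rw [h] at hD2; norm_num at hD2
  have hvan : (μ 1 - μ 0) * (μ 2 - μ 0) * (μ 2 - μ 1) * D = 0 := by
    have hz0 := discrCubic_eq_zero_of_zonal hz (b 0 + b 1 + b 2)
    have e0 : (fun j => (b 0 + b 1 + b 2) j) = (fun j => b 0 j) + (fun j => b 1 j) + (fun j => b 2 j) := by
      funext j; simp
    have e1 : Q *ᵥ (fun j => (b 0 + b 1 + b 2) j) = μ 0 • (fun j => b 0 j) + μ 1 • (fun j => b 1 j) + μ 2 • (fun j => b 2 j) := by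
      rw [e0, Matrix.mulVec_add, Matrix.mulVec_add, hb 0, hb 1, hb 2]
    have e2 : (Q * Q) *ᵥ (fun j => (b 0 + b 1 + b 2) j)
        = (μ 0 * μ 0) • (fun j => b 0 j) + (μ 1 * μ 1) • (fun j => b 1 j) + (μ 2 * μ 2) • (fun j => b 2 j) := by
      rw [← Matrix.mulVec_mulVec, e1, Matrix.mulVec_add, Matrix.mulVec_add, Matrix.mulVec_smul, Matrix.mulVec_smul,
        Matrix.mulVec_smul, hb 0, hb 1, hb 2, smul_smul, smul_smul, smul_smul]
    unfold discrCubic at hz0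
    rw [e2, e1, e0, det_rows_three] at hz0
    simp only [Pi.add_apply, Pi.smul_apply, smul_eq_mul] at hz0
    rw [hD_def]
    linear_combination hz0
  have hμ : μ 0 = μ 1 ∨ μ 0 = μ 2 ∨ μ 1 = μ 2 := by
    rcases mul_eq_zero.mp hvan with h | h
    · rcases mul_eq_zero.mp h with h | h
      · rcases mul_eq_zero.mp h with h | h
        · left; linarith
        · right; left; linarith
      · right; right; linarith
    · exact absurd h hD
  rcases hμ with h | h | h
  · refine ⟨b 2, b.orthonormal.1 2, μ 0, μ 2 - μ 0, fun y => ?_⟩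
    rw [hquad, hpars]; linear_combination (-(⟪b 1, y⟫_ℝ ^ 2)) * h
  · refine ⟨b 1, b.orthonormal.1 1, μ 0, μ 1 - μ 0, fun y => ?_⟩
    rw [hquad, hpars]; linear_combination (-(⟪b 2, y⟫_ℝ ^ 2)) * h
  · refine ⟨b 0, b.orthonormal.1 0, μ 1, μ 0 - μ 1, fun y => ?_⟩
    rw [hquad, hpars]; linear_combination (-(⟪b 2, y⟫_ℝ ^ 2)) * h

end Zonal

/-! ## Part Z2 — S-Z: a zonal shell is axisymmetric about the axis of its form, with one generator for all profiles -/

section Axis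

open Literature.Analysis.FluidPDE

/-- `R_θ` fixes `e₂`. -/
theorem rotZ_single_two' (θ : ℝ) : rotZ θ (EuclideanSpace.single 2 (1:ℝ)) = EuclideanSpace.single 2 (1:ℝ) := by
  ext i
  fin_cases i <;> simp [rotZ]

/-- `⟪J w, w⟫ = 0` for the rotation generator `J`. -/
theorem inner_rotGen_self_zero (w : E3) : ⟪rotGen w, w⟫_ℝ = 0 := by
  rw [Literature.Geometry.Lorentzian.Kerr.Ingoing.inner_e3]
  simp only [rotGen_apply_zero, rotGen_apply_one, rotGen_apply_two]
  ring

/-- a linear isometry of `ℝ³` taking `e₂` to a given unit vector (a Householder reflection). -/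
theorem exists_isometry_map_single_two (n : E3) (hn : ‖n‖ = 1) :
    ∃ P : E3 ≃ₗᵢ[ℝ] E3, P (EuclideanSpace.single 2 (1:ℝ)) = n := by
  refine ⟨(ℝ ∙ (EuclideanSpace.single (2 : Fin 3) (1:ℝ) - n))ᗮ.reflection, ?_⟩
  exact Submodule.reflection_sub (by rw [hn]; simp)

/-- the profile factor `φ(y) = h(‖y‖²)(a‖y‖² + d⟪n,y⟫²)` is smooth. -/
theorem contDiff_profileFactor {h : ℝ → ℝ} (hh : ContDiff ℝ ((⊤ : ℕ∞) : WithTop ℕ∞) h) (n : E3) (a d : ℝ) :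
    ContDiff ℝ ((⊤ : ℕ∞) : WithTop ℕ∞) (fun y : E3 => (h (‖y‖ ^ 2) * (a * ‖y‖ ^ 2 + d * ⟪n, y⟫_ℝ ^ 2)) • y) := by
  have h1 : ContDiff ℝ ((⊤ : ℕ∞) : WithTop ℕ∞) (fun y : E3 => ‖y‖ ^ 2) := contDiff_norm_sq ℝ
  have h2 : ContDiff ℝ ((⊤ : ℕ∞) : WithTop ℕ∞) (fun y : E3 => ⟪n, y⟫_ℝ) := contDiff_const.inner ℝ contDiff_id
  exact ((hh.comp h1).mul ((contDiff_const.mul h1).add (contDiff_const.mul (h2.pow 2)))).smul contDiff_id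

/-- **S-Z `ZonalSepShellAxisymUniform` BY NAME**: a zonal form gives an axisymmetric shell, with ONE generator serving every admissible profile
and every centre — the rotation generator about the axis of the form, conjugated into place by a Householder isometry; the shell
`curl curl (H(|y|) Y_Q(y) y)` is conjugation-covariant (`curl_conj_linearIsometryEquiv` twice, `det² = 1`), hence axisymmetric in the
tree's sense after conjugation, and `IsAxisymmetric.fderiv_rotGen` is the infinitesimal identity. -/
theorem zonalSepShellAxisymUniform_holds : ZonalSepShellAxisymUniform := by
  intro Q hQ hz
  obtain ⟨n, hn, a, d, hquad⟩ := zonal_structure hQ hz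
  obtain ⟨P, hP⟩ := exists_isometry_map_single_two n hn
  have hPsymm : P.symm n = EuclideanSpace.single 2 (1:ℝ) := by
    rw [← hP, LinearIsometryEquiv.symm_apply_apply]
  -- the generator: the conjugated rotation generator
  refine ⟨(P : E3 →L[ℝ] E3).comp (rotGenL.comp (P.symm : E3 →L[ℝ] E3)), fun x => ?_, ?_, ?_⟩
  · -- skew
    have e : ((P : E3 →L[ℝ] E3).comp (rotGenL.comp (P.symm : E3 →L[ℝ] E3))) x = P (rotGen (P.symm x)) := rfl
    rw [e]
    calc ⟪P (rotGen (P.symm x)), x⟫_ℝ = ⟪P (rotGen (P.symm x)), P (P.symm x)⟫_ℝ := by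
          rw [LinearIsometryEquiv.apply_symm_apply]
      _ = ⟪rotGen (P.symm x), P.symm x⟫_ℝ := LinearIsometryEquiv.inner_map_map P _ _
      _ = 0 := inner_rotGen_self_zero _
  · -- non-zero
    intro h0
    have h1 : P (rotGen (EuclideanSpace.single (0 : Fin 3) (1:ℝ))) = 0 := by
      have := congrArg (fun B : E3 →L[ℝ] E3 => B (P (EuclideanSpace.single (0 : Fin 3) (1:ℝ)))) h0
      simpa using this
    have h2 : rotGen (EuclideanSpace.single (0 : Fin 3) (1:ℝ)) = 0 := P.injective (by rw [h1, map_zero])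
    have h3 := congrArg (fun v : E3 => v 1) h2
    simp at h3
  · -- the infinitesimal identity
    intro H x₀ hAdm x
    obtain ⟨⟨h, hh, hHh⟩, -⟩ := hAdm
    -- the centred potential field and its invariance
    set G₀ : E3 → E3 := fun y => (h (‖y‖ ^ 2) * (a * ‖y‖ ^ 2 + d * ⟪n, y⟫_ℝ ^ 2)) • y with hG₀
    have hG₀s : ContDiff ℝ ((⊤ : ℕ∞) : WithTop ℕ∞) G₀ := contDiff_profileFactor hh n a d
    -- the rotations about the axis `n`
    have hrot : ∀ θ : ℝ, ∀ y : E3, G₀ (P (rotZ θ (P.symm y))) = P (rotZ θ (P.symm (G₀ y))) := by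
      intro θ y
      have hnorm : ‖P (rotZ θ (P.symm y))‖ = ‖y‖ := by
        rw [LinearIsometryEquiv.norm_map, norm_rotZ, LinearIsometryEquiv.norm_map]
      have hinner : ⟪n, P (rotZ θ (P.symm y))⟫_ℝ = ⟪n, y⟫_ℝ := by
        have e1 : n = P (rotZ θ (P.symm n)) := by rw [hPsymm, rotZ_single_two', hP]
        conv_lhs => rw [e1]
        rw [LinearIsometryEquiv.inner_map_map]
        have e2 : ⟪rotZ θ (P.symm n), rotZ θ (P.symm y)⟫_ℝ = ⟪P.symm n, P.symm y⟫_ℝ := by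
          have := LinearIsometryEquiv.inner_map_map (rotZLIE θ) (P.symm n) (P.symm y)
          simpa using this
        rw [e2, LinearIsometryEquiv.inner_map_map]
      simp only [hG₀, hnorm, hinner]
      rw [← rotZLIE_apply θ (P.symm (_ • y)), map_smul, map_smul, map_smul, rotZLIE_apply]
    -- the conjugated field is axisymmetric in the tree's sense
    set Gt : E3 → E3 := fun z => P.symm (G₀ (P z)) with hGt
    have hGt_ax : IsAxisymmetric Gt := by
      intro θ z
      simp only [hGt]
      have := hrot θ (P z)
      rw [LinearIsometryEquiv.symm_apply_apply] at this
      rw [this, LinearIsometryEquiv.symm_apply_apply]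
    have hGts : ContDiff ℝ ((⊤ : ℕ∞) : WithTop ℕ∞) Gt := by
      simp only [hGt]
      exact (P.symm : E3 →L[ℝ] E3).contDiff.comp (hG₀s.comp (P : E3 →L[ℝ] E3).contDiff)
    have hGtd : Differentiable ℝ Gt := hGts.differentiable (by simp)
    have hcGt : ContDiff ℝ ((⊤ : ℕ∞) : WithTop ℕ∞) (curl Gt) := contDiff_curl (n := ⊤) (by simpa using hGts)
    have hcGtd : Differentiable ℝ (curl Gt) := hcGt.differentiable (by simp)
    have hccGt : ContDiff ℝ ((⊤ : ℕ∞) : WithTop ℕ∞) (curl (curl Gt)) := contDiff_curl (n := ⊤) (by simpa using hcGt)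
    have hccGtd : Differentiable ℝ (curl (curl Gt)) := hccGt.differentiable (by simp)
    have hax2 : IsAxisymmetric (curl (curl Gt)) := (hGt_ax.curl hGtd).curl hcGtd
    -- conjugation covariance of the double curl
    have hdet := det_linearIsometryEquiv_mul_self P.symm
    have hcurl1 : curl Gt = fun z => (P.symm : E3 →L[ℝ] E3).det • P.symm (curl G₀ (P z)) := by
      funext z
      have := curl_conj_linearIsometryEquiv P.symm G₀ z
      simp only [LinearIsometryEquiv.symm_symm] at this
      simpa [hGt] using this
    have hcurl2 : curl (curl Gt) = fun z => P.symm (curl (curl G₀) (P z)) := by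
      funext z
      rw [hcurl1]
      have e1 : (fun z => (P.symm : E3 →L[ℝ] E3).det • P.symm (curl G₀ (P z)))
          = fun z => P.symm (((P.symm : E3 →L[ℝ] E3).det • curl G₀) (P z)) := by
        funext w; simp [map_smul]
      rw [e1]
      have := curl_conj_linearIsometryEquiv P.symm ((P.symm : E3 →L[ℝ] E3).det • curl G₀) z
      simp only [LinearIsometryEquiv.symm_symm] at this
      rw [this]
      have e2 : curl ((P.symm : E3 →L[ℝ] E3).det • curl G₀) (P z) = (P.symm : E3 →L[ℝ] E3).det • curl (curl G₀) (P z) := by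
        have := curl_const_smul_field ((P.symm : E3 →L[ℝ] E3).det) (curl G₀) (P z)
        simpa [Pi.smul_def] using this
      rw [e2, map_smul, smul_smul, hdet, one_smul]
    -- the infinitesimal identity for `v₀ = curl curl G₀` at `y = x − x₀`
    set v₀ : E3 → E3 := curl (curl G₀) with hv₀
    have hinf : ∀ y : E3, fderiv ℝ v₀ y (P (rotGen (P.symm y))) = P (rotGen (P.symm (v₀ y))) := by
      intro y
      have h1 := hax2.fderiv_rotGen (x := P.symm y) (hccGtd _)
      rw [hcurl2] at h1
      have h3 := fderiv_conj_linearIsometryEquiv P.symm v₀ (P.symm y)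
      simp only [LinearIsometryEquiv.symm_symm, LinearIsometryEquiv.apply_symm_apply] at h3
      rw [h3] at h1
      simp only [ContinuousLinearMap.comp_apply, LinearIsometryEquiv.coe_coe,
        ContinuousLinearEquiv.coe_coe, LinearIsometryEquiv.apply_symm_apply] at h1
      have h2 := congrArg P h1
      simpa using h2
    -- the shell is the translate of `v₀`
    have hshell : sepShell H Q x₀ = fun x => v₀ (x + -x₀) := by
      have e0 : (fun x : E3 => (H ‖x - x₀‖ * quadY Q (x - x₀)) • (x - x₀)) = fun x => G₀ (x + -x₀) := by
        funext x
        simp only [hG₀, ← sub_eq_add_neg, hHh _ (norm_nonneg _), hquad]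
      unfold sepShell
      rw [e0]
      have e1 : curl (fun x => G₀ (x + -x₀)) = fun x => curl G₀ (x + -x₀) := funext fun x => curl_comp_add_const G₀ (-x₀) x
      rw [e1]
      exact funext fun x => curl_comp_add_const (curl G₀) (-x₀) x
    have e : ((P : E3 →L[ℝ] E3).comp (rotGenL.comp (P.symm : E3 →L[ℝ] E3))) (x - x₀) = P (rotGen (P.symm (x - x₀))) := rfl
    rw [e, hshell, fderiv_comp_add_right, ← sub_eq_add_neg, hinf (x - x₀)]
    simp [sub_eq_add_neg]

end Axis

end Summit.NavierStokesRegularity.NavierStokesRegularity.Theorems.UnthreadedRigidity.ProfileHorn
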